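import Literature.NumberTheory.Automorphic.BrandtModuleRamifiedFibre
import Literature.NumberTheory.Automorphic.BrandtModuleEichlerResidue
import Literature.NumberTheory.Automorphic.QuaternionDefiniteNorm
import HarnessLib

/-!
# Brandt matrices prime to the level commute: `brandtMatrix_comm_holds`

Twentieth and last layer of the proof files for the named fact `brandtMatrix_comm` of
`BrandtModule.lean` (Vignéras, LNM 800, III §5 exercice 5.8 (c)–(d); Eichler 1973, II §6
Thm. 2 (18)–(19)): for every Eichler package `P` (level `N⁺`, definite of discriminant `N⁻`) and
`m, n` prime to `N⁺ N⁻`, `B(m) B(n) = B(n) B(m)`.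

Assembly of the printed proof: by coprime multiplicativity (`BrandtData.ofOrder_T_mul_of_coprime`,
Eichler (18)) it suffices that `B(p^a)` and `B(p^b)` commute for each prime `p ∤ N⁺`; the
Eichler order is residually split or residually ramified at such `p`
(`IsEichlerOrder.residuallySplit_or_ramified`, from the classification of maximal orders modulo
`p` in `BrandtModuleResidue*.lean`), the fibres of the chain map have `p + 1` / `1` resp. `1`
elements (`BrandtModuleSplitLocal`, `BrandtModuleRamifiedFibre`), whence the Hecke recursion
`B(p^{a+1}) B(p) = B(p^{a+2}) + c B(p^a)` and commutativity (`BrandtModuleHecke`).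

## References

* M.-F. Vignéras, *Arithmétique des algèbres de quaternions*, LNM 800 (1980), Ch. III §5
  exercice 5.8 (c)–(d), p. 100 [VignerasLNM800].
* M. Eichler, *The basis problem for modular forms and the traces of the Hecke operators*,
  LNM 320 (1973), Ch. II §6 Thm. 2 (18)–(19) [Eichler1973].
-/

noncomputable section

open scoped Pointwise

namespace Literature.NumberTheory.Automorphic

/-- **Brandt matrices at powers of a prime `p ∤ N⁺` commute** for the Brandt data of an Eichler
package. [cite: VignerasLNM800, Ch. III §5 exercice 5.8 (c)] -/
theorem EichlerPackage.commute_T_prime_pow {Nplus Nminus : ℕ} (P : EichlerPackage Nplus Nminus)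
    {p : ℕ} (hp : p.Prime) (hpN : p.Coprime Nplus) (a b : ℕ) :
    Commute (P.brandtData.T (p ^ a)) (P.brandtData.T (p ^ b)) := by
  have hdiv : ∀ x : P.B, x ≠ 0 → IsUnit x := fun x hx => isUnit_of_isTotallyDefinite P.B P.isTotallyDefinite hx
  change Commute ((BrandtData.ofOrder P.O P.isEichlerOrder.isZOrder).T (p ^ a))
    ((BrandtData.ofOrder P.O P.isEichlerOrder.isZOrder).T (p ^ b))
  rcases P.isEichlerOrder.residuallySplit_or_ramified hp hpN with hs | hr
  · exact BrandtData.ofOrder_commute_T_prime_pow _ hp p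
      (fun a i K hK => (hs.card_fibre hdiv hp (RightIdealClass.isInvertibleRightIdeal_rep i) K).1 hK)
      (fun a i K hK => (hs.card_fibre hdiv hp (RightIdealClass.isInvertibleRightIdeal_rep i) K).2 hK) a b
  · exact BrandtData.ofOrder_commute_T_prime_pow _ hp 0
      (fun a i K _ => by rw [hr.card_fibre_eq_one hdiv hp (RightIdealClass.isInvertibleRightIdeal_rep i) K])
      (fun a i K _ => hr.card_fibre_eq_one hdiv hp (RightIdealClass.isInvertibleRightIdeal_rep i) K) a b

/-- **`B(m)` and `B(n)` commute for `m, n` prime to `N⁺`** (Brandt data of an Eichler package):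
induction over the coprime factorisations of `m` and `n`. [cite: VignerasLNM800, Ch. III §5 exercice 5.8 (c)–(d)] -/
theorem EichlerPackage.commute_T_of_coprime_level {Nplus Nminus : ℕ} (P : EichlerPackage Nplus Nminus) :
    ∀ m : ℕ, m.Coprime Nplus → ∀ n : ℕ, n.Coprime Nplus →
      Commute ((BrandtData.ofOrder P.O P.isEichlerOrder.isZOrder).T m)
        ((BrandtData.ofOrder P.O P.isEichlerOrder.isZOrder).T n) := by
  -- inner induction: a prime power against anything
  have hinner : ∀ (q k : ℕ), q.Prime → 0 < k → q.Coprime Nplus → ∀ n : ℕ, n.Coprime Nplus →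
      Commute ((BrandtData.ofOrder P.O P.isEichlerOrder.isZOrder).T (q ^ k))
        ((BrandtData.ofOrder P.O P.isEichlerOrder.isZOrder).T n) := by
    intro q k hq hk hqN n
    induction n using Nat.recOnPosPrimePosCoprime with
    | prime_pow q' k' hq' hk' =>
      intro hn
      by_cases hqq : q = q'
      · subst hqq
        exact P.commute_T_prime_pow hq hqN k k'
      · have hcop : (q ^ k).Coprime (q' ^ k') := Nat.Coprime.pow _ _ ((Nat.coprime_primes hq hq').mpr hqq)
        change _ * _ = _ * _
        rw [← BrandtData.ofOrder_T_mul_of_coprime P.isEichlerOrder.isZOrder hcop,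
          ← BrandtData.ofOrder_T_mul_of_coprime P.isEichlerOrder.isZOrder hcop.symm, mul_comm]
    | zero => intro _; rw [BrandtData.ofOrder_T_zero]; exact Commute.zero_right _
    | one => intro _; rw [BrandtData.ofOrder_T_one]; exact Commute.one_right _
    | coprime a b _ _ hab iha ihb =>
      intro hn
      rw [BrandtData.ofOrder_T_mul_of_coprime P.isEichlerOrder.isZOrder hab]
      exact (iha (Nat.Coprime.coprime_mul_right hn)).mul_right (ihb (Nat.Coprime.coprime_mul_left hn))
  intro m
  induction m using Nat.recOnPosPrimePosCoprime with
  | prime_pow q k hq hk =>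
    intro hm n hn
    exact hinner q k hq hk ((Nat.coprime_pow_left_iff hk _ _).mp hm) n hn
  | zero => intro _ n _; rw [BrandtData.ofOrder_T_zero]; exact Commute.zero_left _
  | one => intro _ n _; rw [BrandtData.ofOrder_T_one]; exact Commute.one_left _
  | coprime a b _ _ hab iha ihb =>
    intro hm n hn
    rw [BrandtData.ofOrder_T_mul_of_coprime P.isEichlerOrder.isZOrder hab]
    exact (iha (Nat.Coprime.coprime_mul_right hm) n hn).mul_left (ihb (Nat.Coprime.coprime_mul_left hm) n hn)

/-- **Brandt matrices prime to the level commute** (the named fact `brandtMatrix_comm`,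
discharged): for every Eichler package and `m, n` prime to `N⁺ N⁻`,
`B(m) B(n) = B(n) B(m)`. [cite: VignerasLNM800, Ch. III §5 exercice 5.8 (c)–(d), p. 100] -/
theorem brandtMatrix_comm_holds : brandtMatrix_comm := fun _ _ P m n hm hn =>
  (P.commute_T_of_coprime_level m (Nat.Coprime.coprime_mul_right_right hm) n
    (Nat.Coprime.coprime_mul_right_right hn)).eq

end Literature.NumberTheory.Automorphic

end
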